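import Literature.MathematicalPhysics.QuantumManyBody.BoseGasHardSet
import Literature.MathematicalPhysics.QuantumManyBody.BoseGasHardCoreCriticalDensity

/-!
# Few pairs near the hard radii: the contact estimate for a general pair potential

Topic `Literature/MathematicalPhysics/QuantumManyBody`, over `BoseGasHardSet.lean` (the hard set
`𝓗(v)`, the hard radii `hardRad v`, `eq_zero_of_dist_mem_hardRad`) and
`BoseGasHardCoreContact.lean` (coordinate lines `linePoint`, Fubini along them
`lintegral_le_of_forall_line`, the one-dimensional Cauchy–Schwarz and fundamental-theorem tools,
`card_filter_dist_lt_le_pow`, `coreSet`).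

`BoseGasHardCoreContact.lean` proves, for a hard core of diameter `a`, that a finite-energy wave
function puts little mass on the shell `a < |xᵢ - xⱼ| < a + δ`. The free-volume argument for a
GENERAL measurable finite-range potential needs the same for the whole **tight region**

* `tightPair v a δ i j = {X | a < |xᵢ - xⱼ|, dist(|xᵢ - xⱼ|, hard radii of v) < δ}`,

the set of configurations in which the pair `(i, j)` is within `δ` of SOME hard sphere (on every
hard sphere the wave function vanishes, `eq_zero_of_dist_mem_hardRad`; the hard radii form an
arbitrary closed subset of `[0, R₀]` containing `[0, a]`). Main result:

* `sum_lintegral_tightPair_le` — for a `C¹` wave function of finite energy for a potential of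
  range `R₀` whose hard set contains the ball `B(0, a)`, and `0 < δ ≤ a/20`,
  `∑ᵢ ∑_{j≠i} ∫ 1_{tightPair}(X) |ψ|² ≤ 200 (2(R₀+a)/a + 1)³ δ² ∫ |∇ψ|²`.

Proof: as in the hard-sphere case the tight region of a pair is covered by the six open coordinate
cones `(x_{i,k} - x_{j,k})² > |xᵢ - xⱼ|²/4` (`exists_mem_relCone`). On a line parallel to
`e_{i,k}` through a tight configuration in the cone there is, within parameter distance `5δ`, a
configuration with `|xᵢ - xⱼ|` EQUAL to the nearby hard radius (`exists_zero_near`), where the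
fibre function vanishes; the pointwise Poincaré bound `|f(t)|² ≤ 10δ ∫_{(t-5δ,t+5δ)} |f'|²`
(`ennnorm_sq_le_of_zero`) and Tonelli along the line give
`∫_{tight ∩ cone} |f|² ≤ 100 δ² ∫_{thickened} |f'|²` (`lintegral_line_tightCone_le`), where the
thickening is by `5δ` along the line. Where `∇ψ ≠ 0` all particles are `> a` apart, and a
particle `j` whose thickened tight region (w.r.t. `i`) contains the configuration is within
`R₀ + a` of `xᵢ`, so each `i` has at most `(2(R₀+a)/a + 1)³` such partners: summing over the
pairs gives the kinetic energy. Constants are not optimised. Everything is elementary real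
analysis and tagged folklore; the context is LSSY 2005, Ch. 2.

References: E. H. Lieb, R. Seiringer, J. P. Solovej, J. Yngvason, *The Mathematics of the Bose Gas
and its Condensation* (2005) [LSSY2005], Ch. 2.
-/

noncomputable section

open MeasureTheory Filter Topology Set Function Metric
open scoped ENNReal NNReal Interval

namespace Literature.MathematicalPhysics.QuantumManyBody.BoseGas

/-! ### A pointwise Poincaré inequality -/

/-- **Pointwise Poincaré with a zero**: if `f : ℝ → ℂ` has the continuous derivative `f'` and
vanishes at some point of `[t₀, t₁]`, then `|f(t)|² ≤ (t₁ - t₀) ∫_{(t₀,t₁)} |f'|²` for every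
`t ∈ [t₀, t₁]` (fundamental theorem of calculus and Cauchy–Schwarz). [folklore] -/
theorem ennnorm_sq_le_of_zero {f f' : ℝ → ℂ} {t₀ t₁ tz t : ℝ} (htz : tz ∈ Icc t₀ t₁)
    (ht : t ∈ Icc t₀ t₁) (hzero : f tz = 0) (hderiv : ∀ s, HasDerivAt f (f' s) s)
    (hcont : Continuous f') :
    (‖f t‖₊ : ℝ≥0∞) ^ 2 ≤
      ENNReal.ofReal (t₁ - t₀) * ∫⁻ s in Ioo t₀ t₁, (‖f' s‖₊ : ℝ≥0∞) ^ 2 := by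
  have h01 : t₀ ≤ t₁ := htz.1.trans htz.2
  set J : ℝ≥0∞ := ∫⁻ s in Ioo t₀ t₁, (‖f' s‖₊ : ℝ≥0∞) with hJ
  set K : ℝ≥0∞ := ∫⁻ s in Ioo t₀ t₁, (‖f' s‖₊ : ℝ≥0∞) ^ 2 with hK
  have hpt : (‖f t‖₊ : ℝ≥0∞) ≤ J := by
    have hftc : ∫ s in tz..t, f' s = f t - f tz :=
      intervalIntegral.integral_eq_sub_of_hasDerivAt (fun s _ => hderiv s)
        (hcont.intervalIntegrable _ _)
    rw [hzero, sub_zero] at hftc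
    have hn : ‖f t‖ ≤ |∫ s in tz..t, ‖f' s‖| := by
      rw [← hftc]; exact intervalIntegral.norm_integral_le_abs_integral_norm
    have hsub : Ι tz t ⊆ Ι t₀ t₁ := by
      refine Set.uIoc_subset_uIoc_of_uIcc_subset_uIcc (Set.uIcc_subset_uIcc ?_ ?_)
      · rw [Set.uIcc_of_le h01]; exact htz
      · rw [Set.uIcc_of_le h01]; exact ht
    have hmono : |∫ s in tz..t, ‖f' s‖| ≤ |∫ s in t₀..t₁, ‖f' s‖| :=
      intervalIntegral.abs_integral_mono_interval hsub
        (Filter.Eventually.of_forall fun _ => norm_nonneg _)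
        (hcont.norm.intervalIntegrable _ _)
    have hint : |∫ s in t₀..t₁, ‖f' s‖| = ∫ s in Ioc t₀ t₁, ‖f' s‖ := by
      rw [intervalIntegral.integral_of_le h01,
        abs_of_nonneg (setIntegral_nonneg measurableSet_Ioc fun _ _ => norm_nonneg _)]
    have hreal : ‖f t‖ ≤ ∫ s in Ioc t₀ t₁, ‖f' s‖ := hn.trans (hint ▸ hmono)
    have hlin : ENNReal.ofReal (∫ s in Ioc t₀ t₁, ‖f' s‖) =
        ∫⁻ s in Ioc t₀ t₁, (‖f' s‖₊ : ℝ≥0∞) := by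
      rw [ofReal_integral_eq_lintegral_ofReal
        ((hcont.norm.integrableOn_Icc).mono_set Ioc_subset_Icc_self)
        (Filter.Eventually.of_forall fun _ => norm_nonneg _)]
      simp_rw [ofReal_norm]
      rfl
    calc (‖f t‖₊ : ℝ≥0∞) = ENNReal.ofReal ‖f t‖ := (ofReal_norm (f t)).symm
      _ ≤ ENNReal.ofReal (∫ s in Ioc t₀ t₁, ‖f' s‖) := ENNReal.ofReal_le_ofReal hreal
      _ = ∫⁻ s in Ioc t₀ t₁, (‖f' s‖₊ : ℝ≥0∞) := hlin
      _ = J := (setLIntegral_congr Ioo_ae_eq_Ioc).symm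
  have hCS : J ^ 2 ≤ ENNReal.ofReal (t₁ - t₀) * K := by
    have := setLIntegral_sq_le_measure_mul volume (φ := fun s => (‖f' s‖₊ : ℝ≥0∞))
      hcont.measurable.nnnorm.coe_nnreal_ennreal.aemeasurable (Ioo t₀ t₁)
    simpa [Real.volume_Ioo] using this
  exact (pow_le_pow_left' hpt 2).trans hCS

/-! ### The tight region of a pair, the coordinate cones and the thickening along a line -/

section Sets

variable {N : ℕ} {v : ℝ → ℝ≥0∞} {a δ : ℝ}

/-- The **tight region** of the pair `(i, j)`: beyond the core (`a < |xᵢ - xⱼ|`) and within `δ`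
of a hard radius of `v`. [folklore] -/
def tightPair (v : ℝ → ℝ≥0∞) (a δ : ℝ) (i j : Fin N) : Set (Config N) :=
  {X | a < dist (X i) (X j) ∧ ∃ h ∈ hardRad v, |dist (X i) (X j) - h| < δ}

/-- The open coordinate cone of the pair `(i, j)` along the axis `k`, on the side
`σ (x_{i,k} - x_{j,k}) > 0`: `|xᵢ - xⱼ|² < 4 (x_{i,k} - x_{j,k})²`. [folklore] -/
def relCone (i j : Fin N) (k : Fin 3) (σ : ℝ) : Set (Config N) :=
  {X | 0 < σ * (X i k - X j k) ∧ dist (X i) (X j) ^ 2 < 4 * (X i k - X j k) ^ 2}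

/-- The thickening of a set of configurations by `w` along the direction `e_{i,k}`. [folklore] -/
def lineThick (S : Set (Config N)) (i : Fin N) (k : Fin 3) (w : ℝ) : Set (Config N) :=
  {X | ∃ τ : ℝ, |τ| < w ∧ X + τ • unitVec i k ∈ S}

/-- The tight region is open. [folklore] -/
theorem isOpen_tightPair (i j : Fin N) : IsOpen (tightPair v a δ i j : Set (Config N)) := by
  have hd : Continuous fun X : Config N => dist (X i) (X j) :=
    (continuous_apply i).dist (continuous_apply j)
  have hU : IsOpen {r : ℝ | ∃ h ∈ hardRad v, |r - h| < δ} := by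
    have : {r : ℝ | ∃ h ∈ hardRad v, |r - h| < δ} = ⋃ h ∈ hardRad v, {r | |r - h| < δ} := by
      ext r; simp
    rw [this]
    refine isOpen_biUnion fun h _ => ?_
    exact isOpen_lt (continuous_id.sub continuous_const).abs continuous_const
  have h1 : IsOpen {X : Config N | a < dist (X i) (X j)} := isOpen_lt continuous_const hd
  have h2 : IsOpen {X : Config N | ∃ h ∈ hardRad v, |dist (X i) (X j) - h| < δ} :=
    hU.preimage hd
  exact h1.inter h2

/-- The coordinate cone is open. [folklore] -/
theorem isOpen_relCone (i j : Fin N) (k : Fin 3) (σ : ℝ) :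
    IsOpen (relCone i j k σ : Set (Config N)) := by
  have hd : Continuous fun X : Config N => dist (X i) (X j) :=
    (continuous_apply i).dist (continuous_apply j)
  refine (isOpen_lt continuous_const ((continuous_coord_sub i j k).const_mul σ)).inter ?_
  exact isOpen_lt (hd.pow 2) (((continuous_coord_sub i j k).pow 2).const_mul 4)

/-- The thickening of an open set is open. [folklore] -/
theorem isOpen_lineThick {S : Set (Config N)} (hS : IsOpen S) (i : Fin N) (k : Fin 3) (w : ℝ) :
    IsOpen (lineThick S i k w) := by
  have : lineThick S i k w = ⋃ τ ∈ {τ : ℝ | |τ| < w}, (fun X : Config N => X + τ • unitVec i k) ⁻¹' S := by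
    ext X; simp [lineThick]
  rw [this]
  exact isOpen_biUnion fun τ _ => hS.preimage (continuous_id.add continuous_const)

/-- **Covering of the tight region by the six coordinate cones**: a pair at positive distance lies
in the cone of its largest coordinate difference. [folklore] -/
theorem exists_mem_relCone {i j : Fin N} {X : Config N} (hX : 0 < dist (X i) (X j)) :
    ∃ k : Fin 3, ∃ σ : ℝ, (σ = 1 ∨ σ = -1) ∧ X ∈ relCone i j k σ := by
  obtain ⟨k, hk⟩ := exists_dist_sq_le_three_mul_coord_sq (X i) (X j)
  have hpos : 0 < dist (X i) (X j) ^ 2 := by positivity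
  have hne : X i k - X j k ≠ 0 := by
    intro h; rw [h] at hk; nlinarith
  have hcone : dist (X i) (X j) ^ 2 < 4 * (X i k - X j k) ^ 2 := by
    have : 0 < (X i k - X j k) ^ 2 := by positivity
    nlinarith
  rcases lt_or_gt_of_ne hne with hlt | hgt
  · exact ⟨k, -1, Or.inr rfl, by nlinarith, hcone⟩
  · exact ⟨k, 1, Or.inl rfl, by nlinarith, hcone⟩

/-- The covering in indicator form. [folklore] -/
theorem indicator_tightPair_le_sum (ha : 0 ≤ a) (i j : Fin N) (f : Config N → ℝ≥0∞)
    (X : Config N) :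
    (tightPair v a δ i j).indicator f X ≤
      ∑ k : Fin 3, ((tightPair v a δ i j ∩ relCone i j k 1).indicator f X +
        (tightPair v a δ i j ∩ relCone i j k (-1)).indicator f X) := by
  by_cases hX : X ∈ tightPair v a δ i j
  · obtain ⟨k, σ, hσ, hmem⟩ := exists_mem_relCone (ha.trans_lt hX.1)
    rw [indicator_of_mem hX]
    refine le_trans ?_ (Finset.single_le_sum (f := fun k =>
      (tightPair v a δ i j ∩ relCone i j k 1).indicator f X +
        (tightPair v a δ i j ∩ relCone i j k (-1)).indicator f X) (fun _ _ => zero_le)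
      (Finset.mem_univ k))
    rcases hσ with rfl | rfl
    · rw [indicator_of_mem (show X ∈ _ ∩ _ from ⟨hX, hmem⟩)]; exact le_self_add
    · rw [indicator_of_mem (show X ∈ tightPair v a δ i j ∩ relCone i j k (-1) from ⟨hX, hmem⟩)]
      exact le_add_self
  · rw [indicator_of_notMem hX]; exact zero_le

end Sets

/-! ### The estimate on one coordinate line -/

section Fibre

variable {N : ℕ} {v : ℝ → ℝ≥0∞} {a δ R₀ : ℝ}

/-- `|√A - √B| ≤ |A - B| / √A` for `A > 0`, `B ≥ 0`. [folklore] -/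
theorem abs_sqrt_sub_sqrt_le {A B : ℝ} (hA : 0 < A) (hB : 0 ≤ B) :
    |Real.sqrt A - Real.sqrt B| ≤ |A - B| / Real.sqrt A := by
  have hsA : 0 < Real.sqrt A := Real.sqrt_pos.2 hA
  have hsB : 0 ≤ Real.sqrt B := Real.sqrt_nonneg B
  rw [le_div_iff₀ hsA]
  have key : (Real.sqrt A - Real.sqrt B) * (Real.sqrt A + Real.sqrt B) = A - B := by
    have h1 := Real.mul_self_sqrt hA.le
    have h2 := Real.mul_self_sqrt hB
    nlinarith
  calc |Real.sqrt A - Real.sqrt B| * Real.sqrt A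
      ≤ |Real.sqrt A - Real.sqrt B| * (Real.sqrt A + Real.sqrt B) :=
        mul_le_mul_of_nonneg_left (by linarith) (abs_nonneg _)
    _ = |(Real.sqrt A - Real.sqrt B) * (Real.sqrt A + Real.sqrt B)| := by
        rw [abs_mul, abs_of_pos (by linarith : 0 < Real.sqrt A + Real.sqrt B)]
    _ = |A - B| := by rw [key]

/-- **A zero of the fibre function near every tight point of the cone.** On the coordinate line
through `X` along `e_{i,k}`, if the configuration at parameter `t` is tight (beyond the core `a`,
`20δ ≤ a`) and in the cone `(k, σ)`, then at some parameter `t'`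
with `|t - t'| < 5δ` the pair `(i, j)` is EXACTLY at a hard radius. [folklore] -/
theorem exists_hardRad_near (ha : 0 < a) (hδ : 0 < δ) (hδa : 20 * δ ≤ a)
    {i j : Fin N} (hij : i ≠ j) (k : Fin 3) {σ : ℝ}
    (hσ : σ = 1 ∨ σ = -1) (X : Config N) (y : Fin 3 → ℝ) {t : ℝ}
    (ht : linePoint X i y k t ∈ tightPair v a δ i j ∩ relCone i j k σ) :
    ∃ t' : ℝ, |t - t'| < 5 * δ ∧
      dist (linePoint X i y k t' i) (linePoint X i y k t' j) ∈ hardRad v := by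
  have hji : j ≠ i := fun h => hij h.symm
  set c : ℝ := X j k with hc
  set ρ2 : ℝ := ∑ k' ∈ Finset.univ.erase k, (y k' - X j k') ^ 2 with hρ2
  have hρ2nn : 0 ≤ ρ2 := Finset.sum_nonneg fun _ _ => sq_nonneg _
  have hdist : ∀ s, dist (linePoint X i y k s i) (linePoint X i y k s j) ^ 2 = (s - c) ^ 2 + ρ2 :=
    fun s => dist_linePoint_sq X hji y k s
  have hsub : ∀ s, linePoint X i y k s i k - linePoint X i y k s j k = s - c := fun s =>
    linePoint_sub_apply X hji y k s
  obtain ⟨⟨hra, h, hh, hrh⟩, hcone1, hcone2⟩ := ht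
  set r : ℝ := dist (linePoint X i y k t i) (linePoint X i y k t j) with hr
  rw [hsub] at hcone1 hcone2
  set u : ℝ := t - c with hu
  have hr0 : 0 < r := ha.trans hra
  have hr2 : r ^ 2 = u ^ 2 + ρ2 := hdist t
  have hδr : 20 * δ < r := by linarith
  have hh0 : 0 ≤ h := nonneg_of_mem_hardRad hh
  have hrhabs := abs_lt.1 hrh
  -- `h² ≥ ρ2`
  have hu2 : r ^ 2 < 4 * u ^ 2 := hcone2
  have hρ2lt : ρ2 < 3 / 4 * r ^ 2 := by nlinarith
  have hh2 : ρ2 ≤ h ^ 2 := by nlinarith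
  -- the zero
  set u' : ℝ := Real.sqrt (h ^ 2 - ρ2) with hu'
  have hu'0 : 0 ≤ u' := Real.sqrt_nonneg _
  have hu'2 : u' ^ 2 = h ^ 2 - ρ2 := Real.sq_sqrt (by linarith)
  refine ⟨c + σ * u', ?_, ?_⟩
  · -- `|t - t'| = ||u| - u'| < 5δ`
    have habsu : 0 < |u| := by
      rcases hσ with rfl | rfl
      · rw [one_mul] at hcone1; exact abs_pos.2 hcone1.ne'
      · exact abs_pos.2 (by intro h0; rw [h0] at hcone1; simp at hcone1)
    have hueq : t - (c + σ * u') = σ * (|u| - u') := by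
      rcases hσ with rfl | rfl
      · rw [one_mul, one_mul, abs_of_pos (by rwa [one_mul] at hcone1)]; ring
      · have hneg : u < 0 := by linarith [hcone1]
        rw [abs_of_neg hneg]; ring
    have hσabs : |σ| = 1 := by rcases hσ with rfl | rfl <;> simp
    rw [hueq, abs_mul, hσabs, one_mul]
    -- `|u| = √(u²)`
    have hsq : |u| = Real.sqrt (u ^ 2) := (Real.sqrt_sq_eq_abs u).symm
    rw [hsq, hu']
    have hA : 0 < u ^ 2 := by rw [← sq_abs]; exact pow_pos habsu 2
    refine (abs_sqrt_sub_sqrt_le hA (by linarith)).trans_lt ?_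
    rw [← hsq, div_lt_iff₀ habsu]
    have hAB : |u ^ 2 - (h ^ 2 - ρ2)| = |r - h| * (r + h) := by
      rw [show u ^ 2 - (h ^ 2 - ρ2) = (r - h) * (r + h) by nlinarith, abs_mul,
        abs_of_nonneg (by linarith : 0 ≤ r + h)]
    rw [hAB]
    have hulow : r / 2 < |u| := by
      have : r ^ 2 / 4 < |u| ^ 2 := by rw [sq_abs]; nlinarith
      nlinarith [abs_nonneg u]
    have h1 : |r - h| * (r + h) < δ * (2 * r + δ) := by
      have hrh' : |r - h| < δ := abs_lt.2 hrhabs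
      have : r + h < 2 * r + δ := by linarith
      exact mul_lt_mul'' hrh' this (abs_nonneg _) (by linarith)
    nlinarith
  · -- at `t'` the pair is exactly at the hard radius `h`
    have hd2 : dist (linePoint X i y k (c + σ * u') i) (linePoint X i y k (c + σ * u') j) ^ 2 =
        h ^ 2 := by
      rw [hdist, show c + σ * u' - c = σ * u' by ring, mul_pow]
      have : σ ^ 2 = 1 := by rcases hσ with rfl | rfl <;> norm_num
      rw [this, one_mul, hu'2]; ring
    have hd : dist (linePoint X i y k (c + σ * u') i) (linePoint X i y k (c + σ * u') j) = h :=
      (pow_left_inj₀ dist_nonneg hh0 two_ne_zero).1 hd2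
    rw [hd]; exact hh

/-- Two points of a coordinate line differ by a multiple of the direction. [folklore] -/
theorem linePoint_eq_linePoint_add (X : Config N) (i : Fin N) (y : Fin 3 → ℝ) (k : Fin 3)
    (s t : ℝ) : linePoint X i y k t = linePoint X i y k s + (t - s) • unitVec i k := by
  rw [linePoint_eq_add_smul X i y k t, linePoint_eq_add_smul X i y k s, add_assoc, ← add_smul]
  congr 2; ring

/-- **The tight-cone estimate on a coordinate line.** For a `C¹` wave function vanishing on every
hard sphere, on each line parallel to `e_{i,k}` the mass in `tightPair ∩ relCone(k, σ)` is at
most `100 δ²` times the `e_{i,k}`-derivative energy on the `5δ`-thickening of that set along the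
line. [folklore] -/
theorem lintegral_line_tightCone_le (ha : 0 < a) (hδ : 0 < δ) (hδa : 20 * δ ≤ a)
    {ψ : Config N → ℂ} (hψ : ContDiff ℝ 1 ψ)
    (hzero : ∀ X : Config N, ∀ i j : Fin N, i ≠ j → dist (X i) (X j) ∈ hardRad v → ψ X = 0)
    {i j : Fin N} (hij : i ≠ j) (k : Fin 3) {σ : ℝ} (hσ : σ = 1 ∨ σ = -1) (X : Config N)
    (y : Fin 3 → ℝ) :
    ∫⁻ t, (tightPair v a δ i j ∩ relCone i j k σ).indicator (fun X => (‖ψ X‖₊ : ℝ≥0∞) ^ 2)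
        (linePoint X i y k t) ≤
      ENNReal.ofReal (100 * δ ^ 2) *
        ∫⁻ t, (lineThick (tightPair v a δ i j ∩ relCone i j k σ) i k (5 * δ)).indicator
          (fun X => (‖fderiv ℝ ψ X (unitVec i k)‖₊ : ℝ≥0∞) ^ 2) (linePoint X i y k t) := by
  -- the fibre functions
  set S : Set (Config N) := tightPair v a δ i j ∩ relCone i j k σ with hS
  set L : ℝ → Config N := linePoint X i y k with hL
  set φ : ℝ → ℂ := fun t => ψ (L t) with hφ
  set φ' : ℝ → ℂ := fun t => fderiv ℝ ψ (L t) (unitVec i k) with hφ'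
  have hLeq : L = fun t => linePoint X i y k 0 + t • unitVec i k :=
    funext fun t => linePoint_eq_add_smul X i y k t
  have hLcont : Continuous L := by rw [hLeq]; fun_prop
  have hderiv : ∀ t, HasDerivAt φ (φ' t) t := by
    intro t
    have hline : HasDerivAt (fun s : ℝ => linePoint X i y k 0 + s • unitVec i k)
        (unitVec i k) t := by
      simpa using ((hasDerivAt_id t).smul_const (unitVec i k)).const_add (linePoint X i y k 0)
    have hψd : HasFDerivAt ψ (fderiv ℝ ψ (L t)) (linePoint X i y k 0 + t • unitVec i k) := by
      rw [← linePoint_eq_add_smul]; exact (hψ.differentiable one_ne_zero _).hasFDerivAt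
    have hcomp := hψd.comp_hasDerivAt t hline
    have hfun : (ψ ∘ fun s : ℝ => linePoint X i y k 0 + s • unitVec i k) = φ := by
      funext s; simp [φ, L, ← linePoint_eq_add_smul]
    rwa [hfun] at hcomp
  have hcont' : Continuous φ' :=
    ((hψ.continuous_fderiv one_ne_zero).comp hLcont).clm_apply continuous_const
  -- the sets on the line
  set A : Set ℝ := L ⁻¹' S with hA
  have hSo : IsOpen S := (isOpen_tightPair i j).inter (isOpen_relCone i j k σ)
  have hAm : MeasurableSet A := (hSo.preimage hLcont).measurableSet
  set w : ℝ := 5 * δ with hw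
  have hw0 : 0 < w := by positivity
  set A' : Set ℝ := {s | ∃ t ∈ A, |s - t| < w} with hA'
  have hA'sub : ∀ s ∈ A', L s ∈ lineThick S i k w := by
    rintro s ⟨t, ht, hst⟩
    refine ⟨t - s, by rwa [abs_sub_comm], ?_⟩
    rw [← linePoint_eq_linePoint_add]; exact ht
  have hA'o : IsOpen A' := by
    have : A' = ⋃ t ∈ A, {s | |s - t| < w} := by ext s; simp [hA']
    rw [this]
    exact isOpen_biUnion fun t _ => isOpen_lt (continuous_id.sub continuous_const).abs
      continuous_const
  -- the pointwise Poincaré bound on `A`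
  set g : ℝ → ℝ≥0∞ := fun s => (‖φ' s‖₊ : ℝ≥0∞) ^ 2 with hg
  have hgm : Measurable g := (hcont'.measurable.nnnorm.coe_nnreal_ennreal).pow_const 2
  have hpt : ∀ t ∈ A, (‖φ t‖₊ : ℝ≥0∞) ^ 2 ≤
      ENNReal.ofReal (2 * w) * ∫⁻ s in Ioo (t - w) (t + w), g s := by
    intro t ht
    obtain ⟨t', htt', hmem⟩ := exists_hardRad_near ha hδ hδa hij k hσ X y ht
    have hz : φ t' = 0 := hzero _ i j hij hmem
    have htz : t' ∈ Icc (t - w) (t + w) := by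
      rw [abs_lt] at htt'; constructor <;> linarith
    have htI : t ∈ Icc (t - w) (t + w) := ⟨by linarith, by linarith⟩
    have := ennnorm_sq_le_of_zero htz htI hz hderiv hcont'
    rwa [show t + w - (t - w) = 2 * w by ring] at this
  -- Tonelli along the line
  set H : ℝ → ℝ → ℝ≥0∞ := fun t s =>
    A.indicator (fun _ => (1 : ℝ≥0∞)) t * ((Ioo (t - w) (t + w)).indicator g s) with hH
  have hHm : Measurable fun p : ℝ × ℝ => H p.1 p.2 := by
    have h1 : Measurable fun p : ℝ × ℝ => A.indicator (fun _ => (1 : ℝ≥0∞)) p.1 :=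
      (measurable_const.indicator hAm).comp measurable_fst
    have hO : IsOpen {p : ℝ × ℝ | p.2 ∈ Ioo (p.1 - w) (p.1 + w)} := by
      have : {p : ℝ × ℝ | p.2 ∈ Ioo (p.1 - w) (p.1 + w)} = {p | p.1 - w < p.2} ∩ {p | p.2 < p.1 + w} := by
        ext p; simp [Set.mem_Ioo]
      rw [this]
      exact (isOpen_lt (continuous_fst.sub continuous_const) continuous_snd).inter
        (isOpen_lt continuous_snd (continuous_fst.add continuous_const))
    have h2 : Measurable fun p : ℝ × ℝ => (Ioo (p.1 - w) (p.1 + w)).indicator g p.2 := by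
      have : (fun p : ℝ × ℝ => (Ioo (p.1 - w) (p.1 + w)).indicator g p.2) =
          {p : ℝ × ℝ | p.2 ∈ Ioo (p.1 - w) (p.1 + w)}.indicator (fun p => g p.2) := by
        funext p
        simp only [Set.indicator_apply, Set.mem_setOf_eq]
      rw [this]
      exact (hgm.comp measurable_snd).indicator hO.measurableSet
    exact h1.mul h2
  have hinner : ∀ s, ∫⁻ t, H t s ≤ A'.indicator (fun _ => ENNReal.ofReal (2 * w)) s * g s := by
    intro s
    by_cases hs : s ∈ A'
    · rw [indicator_of_mem hs]
      have hle : ∀ t, H t s ≤ (Ioo (s - w) (s + w)).indicator (fun _ => g s) t := by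
        intro t
        by_cases ht : t ∈ A
        · by_cases hst : s ∈ Ioo (t - w) (t + w)
          · have hts : t ∈ Ioo (s - w) (s + w) := by
              rw [Set.mem_Ioo] at hst ⊢; constructor <;> linarith
            rw [hH]; simp only
            rw [indicator_of_mem ht, indicator_of_mem hst, indicator_of_mem hts, one_mul]
          · rw [hH]; simp only
            rw [indicator_of_notMem hst, mul_zero]; exact zero_le
        · rw [hH]; simp only
          rw [indicator_of_notMem ht, zero_mul]; exact zero_le
      calc ∫⁻ t, H t s ≤ ∫⁻ t, (Ioo (s - w) (s + w)).indicator (fun _ => g s) t := lintegral_mono hle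
        _ = g s * volume (Ioo (s - w) (s + w)) := lintegral_indicator_const measurableSet_Ioo _
        _ = ENNReal.ofReal (2 * w) * g s := by
            rw [Real.volume_Ioo, show s + w - (s - w) = 2 * w by ring, mul_comm]
    · have h0 : ∀ t, H t s = 0 := by
        intro t
        rw [hH]; simp only
        by_cases ht : t ∈ A
        · have hst : s ∉ Ioo (t - w) (t + w) := by
            intro hst
            apply hs
            refine ⟨t, ht, ?_⟩
            rw [Set.mem_Ioo] at hst
            rw [abs_lt]; constructor <;> linarith
          rw [indicator_of_notMem hst, mul_zero]
        · rw [indicator_of_notMem ht, zero_mul]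
      simp [h0]
  -- conclusion
  calc ∫⁻ t, S.indicator (fun X => (‖ψ X‖₊ : ℝ≥0∞) ^ 2) (L t)
      = ∫⁻ t, A.indicator (fun t => (‖φ t‖₊ : ℝ≥0∞) ^ 2) t := by
        refine lintegral_congr fun t => ?_
        by_cases ht : L t ∈ S
        · rw [indicator_of_mem ht, indicator_of_mem (show t ∈ A from ht)]
        · rw [indicator_of_notMem ht, indicator_of_notMem (show t ∉ A from ht)]
    _ ≤ ∫⁻ t, A.indicator (fun t => ENNReal.ofReal (2 * w) * ∫⁻ s in Ioo (t - w) (t + w), g s) t := by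
        refine lintegral_mono fun t => ?_
        by_cases ht : t ∈ A
        · rw [indicator_of_mem ht, indicator_of_mem ht]; exact hpt t ht
        · rw [indicator_of_notMem ht]; exact zero_le
    _ = ∫⁻ t, ENNReal.ofReal (2 * w) * ∫⁻ s, H t s := by
        refine lintegral_congr fun t => ?_
        by_cases ht : t ∈ A
        · rw [indicator_of_mem ht]
          congr 1
          rw [← lintegral_indicator measurableSet_Ioo]
          refine lintegral_congr fun s => ?_
          rw [hH]; simp only
          rw [indicator_of_mem ht, one_mul]
        · rw [indicator_of_notMem ht]
          have h0 : ∀ s, H t s = 0 := fun s => by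
            rw [hH]; simp only
            rw [indicator_of_notMem ht, zero_mul]
          simp [h0]
    _ = ENNReal.ofReal (2 * w) * ∫⁻ s, ∫⁻ t, H t s := by
        rw [lintegral_const_mul' _ _ ENNReal.ofReal_ne_top, lintegral_lintegral_swap hHm.aemeasurable]
    _ ≤ ENNReal.ofReal (2 * w) * ∫⁻ s, A'.indicator (fun _ => ENNReal.ofReal (2 * w)) s * g s :=
        mul_le_mul' le_rfl (lintegral_mono hinner)
    _ ≤ ENNReal.ofReal (2 * w) * ∫⁻ s, ENNReal.ofReal (2 * w) *
          (lineThick S i k w).indicator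
            (fun X => (‖fderiv ℝ ψ X (unitVec i k)‖₊ : ℝ≥0∞) ^ 2) (L s) := by
        refine mul_le_mul' le_rfl (lintegral_mono fun s => ?_)
        by_cases hs : s ∈ A'
        · rw [indicator_of_mem hs, indicator_of_mem (hA'sub s hs)]
        · rw [indicator_of_notMem hs, zero_mul]; exact zero_le
    _ = ENNReal.ofReal (100 * δ ^ 2) * ∫⁻ s, (lineThick S i k w).indicator
          (fun X => (‖fderiv ℝ ψ X (unitVec i k)‖₊ : ℝ≥0∞) ^ 2) (L s) := by
        rw [lintegral_const_mul' _ _ ENNReal.ofReal_ne_top, ← mul_assoc,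
          ← ENNReal.ofReal_mul (by positivity)]
        congr 2
        rw [hw]; ring

end Fibre

/-! ### The estimate on configuration space and the tight-pair bound -/

section Assembly

variable {N : ℕ} {a δ R₀ : ℝ} {v : ℝ → ℝ≥0∞}

/-- The tight-cone estimate for one pair and one cone, on configuration space (Fubini over the
lines parallel to `e_{i,k}`). [folklore] -/
theorem lintegral_tightCone_le (ha : 0 < a) (hδ : 0 < δ) (hδa : 20 * δ ≤ a)
    {ψ : Config N → ℂ} (hψ : ContDiff ℝ 1 ψ)
    (hzero : ∀ X : Config N, ∀ i j : Fin N, i ≠ j → dist (X i) (X j) ∈ hardRad v → ψ X = 0)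
    {i j : Fin N} (hij : i ≠ j) (k : Fin 3) {σ : ℝ} (hσ : σ = 1 ∨ σ = -1) :
    ∫⁻ X, (tightPair v a δ i j ∩ relCone i j k σ).indicator (fun X => (‖ψ X‖₊ : ℝ≥0∞) ^ 2) X ≤
      ENNReal.ofReal (100 * δ ^ 2) * ∫⁻ X,
        (lineThick (tightPair v a δ i j ∩ relCone i j k σ) i k (5 * δ)).indicator
          (fun X => (‖fderiv ℝ ψ X (unitVec i k)‖₊ : ℝ≥0∞) ^ 2) X := by
  have hSo : IsOpen (tightPair v a δ i j ∩ relCone i j k σ : Set (Config N)) :=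
    (isOpen_tightPair i j).inter (isOpen_relCone i j k σ)
  have hF : Measurable fun X => (tightPair v a δ i j ∩ relCone i j k σ).indicator
      (fun X => (‖ψ X‖₊ : ℝ≥0∞) ^ 2) X :=
    (measurable_ennnormSq hψ.continuous).indicator hSo.measurableSet
  have hG : Measurable fun X => (lineThick (tightPair v a δ i j ∩ relCone i j k σ) i k
      (5 * δ)).indicator (fun X => (‖fderiv ℝ ψ X (unitVec i k)‖₊ : ℝ≥0∞) ^ 2) X :=
    (measurable_ennnormSq_fderiv_apply hψ _).indicator (isOpen_lineThick hSo i k _).measurableSet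
  rw [← lintegral_const_mul _ hG]
  refine lintegral_le_of_forall_line i k hF (measurable_const.mul hG) fun X y => ?_
  have hG' : Measurable fun t => (lineThick (tightPair v a δ i j ∩ relCone i j k σ) i k
      (5 * δ)).indicator (fun X => (‖fderiv ℝ ψ X (unitVec i k)‖₊ : ℝ≥0∞) ^ 2)
      (linePoint X i y k t) := hG.comp (continuous_linePoint X i y k).measurable
  rw [lintegral_const_mul _ hG']
  exact lintegral_line_tightCone_le ha hδ hδa hψ hzero hij k hσ X y

/-- Membership in a thickened tight cone forces the partner to be close: if
`X ∈ lineThick (tightPair ∩ relCone) i k (5δ)` then `|xᵢ - xⱼ| < R₀ + 6δ`. [folklore] -/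
theorem dist_lt_of_mem_lineThick (hrad : ∀ h ∈ hardRad v, h ≤ R₀) {i j : Fin N} (hij : i ≠ j)
    {k : Fin 3} {σ : ℝ} {X : Config N}
    (hX : X ∈ lineThick (tightPair v a δ i j ∩ relCone i j k σ) i k (5 * δ)) :
    dist (X i) (X j) < R₀ + 6 * δ := by
  obtain ⟨τ, hτ, ⟨⟨-, h, hh, hrh⟩, -⟩⟩ := hX
  set Y : Config N := X + τ • unitVec i k with hY
  have hYj : Y j = X j := by
    simp [hY, unitVec, hij.symm]
  have hYi : Y i = X i + τ • EuclideanSpace.single k (1 : ℝ) := by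
    simp [hY, unitVec]
  have hdY : dist (Y i) (Y j) < R₀ + δ := by
    have := (abs_lt.1 hrh).2
    linarith [hrad h hh]
  have hXY : dist (X i) (Y i) = |τ| := by
    rw [hYi, dist_eq_norm, show X i - (X i + τ • EuclideanSpace.single k (1:ℝ)) =
      -(τ • EuclideanSpace.single k (1:ℝ)) by abel, norm_neg, norm_smul, Real.norm_eq_abs]
    simp
  calc dist (X i) (X j) ≤ dist (X i) (Y i) + dist (Y i) (X j) := dist_triangle _ _ _
    _ = |τ| + dist (Y i) (Y j) := by rw [hXY, hYj]
    _ < 5 * δ + (R₀ + δ) := add_lt_add hτ hdY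
    _ = R₀ + 6 * δ := by ring

/-- **Few tight pairs at finite energy (general potential).** Let `v` be a measurable potential of
range `R₀` whose hard set contains the ball `B(0, a)`, `0 < δ ≤ a/20`, and `ψ` a `C¹` wave
function of finite energy. Then the expected number of ordered tight pairs is at most
`200 (2(R₀+a)/a + 1)³ δ²` times the kinetic energy:
`∑ᵢ ∑_{j≠i} ∫ 1_{tightPair v a δ i j} |ψ|² ≤ 200 (2(R₀+a)/a+1)³ δ² ∫ |∇ψ|²`. [folklore] -/
theorem sum_lintegral_tightPair_le (ha : 0 < a) (hδ : 0 < δ) (hδa : 20 * δ ≤ a) (hR : 0 ≤ R₀)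
    (hv : Measurable v) (hrange : ∀ r, R₀ < r → v r = 0)
    (hcore : ball (0 : Space) a ⊆ hardVec v) {ψ : Config N → ℂ} (hψ : ContDiff ℝ 1 ψ)
    (hE : rawEnergy v ψ ≠ ⊤) :
    ∑ i : Fin N, ∑ j ∈ Finset.univ.erase i,
        ∫⁻ X, (tightPair v a δ i j).indicator (fun X => (‖ψ X‖₊ : ℝ≥0∞) ^ 2) X ≤
      ENNReal.ofReal (200 * (2 * (R₀ + a) / a + 1) ^ 3 * δ ^ 2) * ∫⁻ X, kineticDensity ψ X := by
  classical
  have hrad : ∀ h ∈ hardRad v, h ≤ R₀ := fun h hh => le_of_mem_hardRad hrange hh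
  -- `ψ` vanishes on every hard sphere, and (with its gradient) wherever two cores overlap
  have hzero : ∀ X : Config N, ∀ i j : Fin N, i ≠ j → dist (X i) (X j) ∈ hardRad v → ψ X = 0 :=
    fun X i j hij hd => eq_zero_of_dist_mem_hardRad hv hψ.continuous hE hij hd
  have hcoreRad : ∀ r, 0 ≤ r → r < a → r ∈ hardRad v := by
    intro r hr0 hra
    refine ⟨hr0, hcore ?_⟩
    rw [mem_ball, dist_zero_right, norm_smul_unitE hr0]; exact hra
  have hzero_core : ∀ X ∈ coreSet a N, ψ X = 0 := by
    rintro X ⟨i, j, hij, hd⟩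
    exact hzero X i j hij (hcoreRad _ dist_nonneg hd)
  have hgrad : ∀ {X : Config N}, fderiv ℝ ψ X ≠ 0 → ∀ j j' : Fin N, j ≠ j' → a ≤ dist (X j) (X j') := by
    intro X hD j j' hjj'
    by_contra hlt
    exact hD (fderiv_eq_zero_of_mem_closure hψ isOpen_coreSet hzero_core
      (mem_closure_coreSet ha hjj' (not_le.1 hlt).le))
  -- notation
  set P : ℝ := (2 * (R₀ + a) / a + 1) ^ 3 with hP
  have hP0 : 0 ≤ P := by positivity
  set f := fun X : Config N => (‖ψ X‖₊ : ℝ≥0∞) ^ 2 with hf_def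
  set g := fun (i : Fin N) (k : Fin 3) (X : Config N) =>
    (‖fderiv ℝ ψ X (unitVec i k)‖₊ : ℝ≥0∞) ^ 2 with hg_def
  have hf : Measurable f := measurable_ennnormSq hψ.continuous
  have hg : ∀ i k, Measurable (g i k) := fun i k => measurable_ennnormSq_fderiv_apply hψ _
  set B := fun (i j : Fin N) (k : Fin 3) (σ : ℝ) =>
    lineThick (tightPair v a δ i j ∩ relCone i j k σ) i k (5 * δ) with hB_def
  have hBm : ∀ i j k σ, MeasurableSet (B i j k σ) := fun i j k σ =>
    (isOpen_lineThick ((isOpen_tightPair i j).inter (isOpen_relCone i j k σ)) i k _).measurableSet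
  -- per pair: cover by cones and apply the cone estimate
  have hpair : ∀ i j : Fin N, i ≠ j →
      ∫⁻ X, (tightPair v a δ i j).indicator f X ≤
        ENNReal.ofReal (100 * δ ^ 2) * ∑ k : Fin 3,
          ((∫⁻ X, (B i j k 1).indicator (g i k) X) + ∫⁻ X, (B i j k (-1)).indicator (g i k) X) := by
    intro i j hij
    have hmc : ∀ k σ, Measurable fun X => (tightPair v a δ i j ∩ relCone i j k σ).indicator f X :=
      fun k σ => hf.indicator ((isOpen_tightPair i j).inter (isOpen_relCone i j k σ)).measurableSet
    calc ∫⁻ X, (tightPair v a δ i j).indicator f X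
        ≤ ∫⁻ X, ∑ k : Fin 3, ((tightPair v a δ i j ∩ relCone i j k 1).indicator f X +
            (tightPair v a δ i j ∩ relCone i j k (-1)).indicator f X) :=
          lintegral_mono fun X => indicator_tightPair_le_sum ha.le i j f X
      _ = ∑ k : Fin 3, ((∫⁻ X, (tightPair v a δ i j ∩ relCone i j k 1).indicator f X) +
            ∫⁻ X, (tightPair v a δ i j ∩ relCone i j k (-1)).indicator f X) := by
          rw [lintegral_finsetSum _ fun k _ =>
            show Measurable (fun X => (tightPair v a δ i j ∩ relCone i j k 1).indicator f X +
              (tightPair v a δ i j ∩ relCone i j k (-1)).indicator f X) from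
              (hmc k 1).add (hmc k (-1))]
          exact Finset.sum_congr rfl fun k _ => lintegral_add_left (hmc k 1) _
      _ ≤ ∑ k : Fin 3, (ENNReal.ofReal (100 * δ ^ 2) * (∫⁻ X, (B i j k 1).indicator (g i k) X) +
            ENNReal.ofReal (100 * δ ^ 2) * ∫⁻ X, (B i j k (-1)).indicator (g i k) X) :=
          Finset.sum_le_sum fun k _ => add_le_add
            (lintegral_tightCone_le ha hδ hδa hψ hzero hij k (Or.inl rfl))
            (lintegral_tightCone_le ha hδ hδa hψ hzero hij k (Or.inr rfl))
      _ = ENNReal.ofReal (100 * δ ^ 2) * ∑ k : Fin 3,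
            ((∫⁻ X, (B i j k 1).indicator (g i k) X) + ∫⁻ X, (B i j k (-1)).indicator (g i k) X) := by
          rw [Finset.mul_sum]
          exact Finset.sum_congr rfl fun k _ => by rw [mul_add]
  -- pointwise neighbour count where the gradient does not vanish
  have hcount : ∀ (X : Config N) (i : Fin N) (k : Fin 3) (σ : ℝ),
      (∑ j ∈ Finset.univ.erase i, (B i j k σ).indicator (g i k) X) ≤ ENNReal.ofReal P * g i k X := by
    intro X i k σ
    by_cases hD : fderiv ℝ ψ X = 0
    · have h0 : g i k X = 0 := by simp [g, hD]
      have h0' : ∀ j, (B i j k σ).indicator (g i k) X = 0 := fun j => by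
        by_cases hX : X ∈ B i j k σ
        · rw [indicator_of_mem hX, h0]
        · rw [indicator_of_notMem hX]
      simp [h0', h0]
    · have hsep := hgrad hD
      calc (∑ j ∈ Finset.univ.erase i, (B i j k σ).indicator (g i k) X)
          ≤ ∑ j ∈ Finset.univ.filter (fun j => j ≠ i ∧ dist (X i) (X j) < R₀ + a), g i k X := by
            rw [← Finset.sum_filter_add_sum_filter_not (Finset.univ.erase i)
              (fun j => X ∈ B i j k σ)]
            have hz : ∑ j ∈ (Finset.univ.erase i).filter (fun j => X ∉ B i j k σ),
                (B i j k σ).indicator (g i k) X = 0 :=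
              Finset.sum_eq_zero fun j hj => indicator_of_notMem (Finset.mem_filter.1 hj).2 _
            rw [hz, add_zero]
            refine (Finset.sum_congr rfl fun j hj =>
              indicator_of_mem (Finset.mem_filter.1 hj).2 _).le.trans ?_
            refine Finset.sum_le_sum_of_subset_of_nonneg (fun j hj => ?_) fun _ _ _ => zero_le
            simp only [Finset.mem_filter, Finset.mem_erase, Finset.mem_univ, true_and,
              and_true] at hj ⊢
            refine ⟨hj.1, ?_⟩
            have h1 := dist_lt_of_mem_lineThick hrad (Ne.symm hj.1) hj.2
            linarith
        _ ≤ ENNReal.ofReal P * g i k X := by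
            rw [Finset.sum_const, nsmul_eq_mul]
            refine mul_le_mul' ?_ le_rfl
            have hc := card_filter_dist_lt_le_pow ha (by linarith : 0 < R₀ + a) hsep i
            calc ((Finset.univ.filter fun j => j ≠ i ∧ dist (X i) (X j) < R₀ + a).card : ℝ≥0∞)
                = ENNReal.ofReal ((Finset.univ.filter fun j => j ≠ i ∧
                    dist (X i) (X j) < R₀ + a).card : ℝ) := by rw [ENNReal.ofReal_natCast]
              _ ≤ ENNReal.ofReal P := ENNReal.ofReal_le_ofReal hc
  -- summing the per-pair bounds
  have hsumB : ∀ (i : Fin N) (k : Fin 3) (σ : ℝ),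
      (∑ j ∈ Finset.univ.erase i, ∫⁻ X, (B i j k σ).indicator (g i k) X) ≤
        ENNReal.ofReal P * ∫⁻ X, g i k X := by
    intro i k σ
    rw [← lintegral_finsetSum _ fun j _ => (hg i k).indicator (hBm i j k σ),
      ← lintegral_const_mul _ (hg i k)]
    exact lintegral_mono fun X => hcount X i k σ
  have hkin : ∑ i : Fin N, ∑ k : Fin 3, ∫⁻ X, g i k X = ∫⁻ X, kineticDensity ψ X := by
    symm
    simp only [kineticDensity]
    rw [lintegral_finsetSum _ fun i _ => Finset.measurable_sum _ fun k _ => hg i k]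
    refine Finset.sum_congr rfl fun i _ => ?_
    rw [lintegral_finsetSum _ fun k _ => hg i k]
  calc ∑ i : Fin N, ∑ j ∈ Finset.univ.erase i, ∫⁻ X, (tightPair v a δ i j).indicator f X
      ≤ ∑ i : Fin N, ∑ j ∈ Finset.univ.erase i, ENNReal.ofReal (100 * δ ^ 2) * ∑ k : Fin 3,
          ((∫⁻ X, (B i j k 1).indicator (g i k) X) + ∫⁻ X, (B i j k (-1)).indicator (g i k) X) :=
        Finset.sum_le_sum fun i _ => Finset.sum_le_sum fun j hj =>
          hpair i j (Finset.ne_of_mem_erase hj).symm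
    _ = ENNReal.ofReal (100 * δ ^ 2) * ∑ i : Fin N, ∑ k : Fin 3,
          ((∑ j ∈ Finset.univ.erase i, ∫⁻ X, (B i j k 1).indicator (g i k) X) +
            ∑ j ∈ Finset.univ.erase i, ∫⁻ X, (B i j k (-1)).indicator (g i k) X) := by
        rw [Finset.mul_sum]
        refine Finset.sum_congr rfl fun i _ => ?_
        rw [← Finset.mul_sum, Finset.sum_comm]
        congr 1
        refine Finset.sum_congr rfl fun k _ => ?_
        rw [Finset.sum_add_distrib]
    _ ≤ ENNReal.ofReal (100 * δ ^ 2) * ∑ i : Fin N, ∑ k : Fin 3,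
          (ENNReal.ofReal P * (∫⁻ X, g i k X) + ENNReal.ofReal P * ∫⁻ X, g i k X) :=
        mul_le_mul' le_rfl (Finset.sum_le_sum fun i _ => Finset.sum_le_sum fun k _ =>
          add_le_add (hsumB i k 1) (hsumB i k (-1)))
    _ = ENNReal.ofReal (100 * δ ^ 2) * ((2 * ENNReal.ofReal P) *
          ∑ i : Fin N, ∑ k : Fin 3, ∫⁻ X, g i k X) := by
        congr 1
        rw [Finset.mul_sum]
        refine Finset.sum_congr rfl fun i _ => ?_
        rw [Finset.mul_sum]
        refine Finset.sum_congr rfl fun k _ => ?_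
        ring
    _ = ENNReal.ofReal (200 * P * δ ^ 2) * ∫⁻ X, kineticDensity ψ X := by
        rw [hkin, ← mul_assoc]
        congr 1
        rw [← ENNReal.ofReal_ofNat 2, ← ENNReal.ofReal_mul (by norm_num),
          ← ENNReal.ofReal_mul (by positivity)]
        congr 1; ring

end Assembly

end Literature.MathematicalPhysics.QuantumManyBody.BoseGas

end
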